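import Summits.ValiantsHypothesis.ValiantsHypothesis.Theorems.LacunarySymmetroidMatrixDescartesDoorA26WallBubblingSignWord
import Literature.Analysis.Convex.GordanAlternativeLogSumExp

/-!
# `DoorA26` / line `wall_bubbling` — THE FIRST-ORDER LIFT IN DUAL FORM (Gordan's alternative): a touch profile lifts unless it is BALANCED

HONEST FRAMING.  Object-search cell `pub-symmetroid`, crux `Theses.LacunarySymmetroid.DoorA26` (stmt-ValiantsHypothesis-19979; OPEN, typed,
never asserted).  W2 seat val-sym-door-p1 g18, file #47; def-free helper for obligation (R) of `Cruxes/DoorA26/Lines/wall_bubbling.lean`, continuing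
#46 `…WallBubblingSignWord` (the Q-lift `mem_twentyLocus_of_touches_alternations_pencilShift`: shifting the letters by ANY same-support symmetric pencil
`Q` lifts a touch profile to a twenty as soon as `κ_j · polar(P(τ_j), Q(τ_j)) > 0` at every touch).

WHAT IS HERE.  The push at a touch `τ_j` is a LINEAR functional of `Q` (18 coordinates: three entries per shift letter); by GORDAN'S ALTERNATIVE
(`gordan`: for finitely many vectors `V_j`, either some `q` has `⟪V_j, q⟫ > 0` for all `j`, or a convex combination of the `V_j` vanishes — CITED from
the tree's `Literature.Analysis.Convex.GordanAlternativeLogSumExp.gordan_alternative`, Borwein–Zhu Thm. 2.4.3, repackaged) EXACTLY ONE of the following holds for a touch set `J`: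
(a) some `Q` realises every push sign — then the Q-lift applies; (b) a BALANCE: weights `μ ≥ 0` on `J`, not all zero, with
`Σ_{j∈J} μ_j κ_j e^{δ_l τ_j} P(τ_j) = 0` for EVERY exponent index `l` (six `2 × 2` matrix equations; the polar form is non-degenerate on symmetric
matrices, `polar_coordShift`).  Hence **`mem_twentyLocus_of_touches_noBalance`**: off `J` the signs `0 < κ_j det P(τ_j)`, on `J` `det P(τ_j) = 0`, NO
balance, `κ` alternating ⇒ `δ ∈ TwentyLocus`.  This is the complete first-order statement of the multiplicity residual for rank-one double zeros: the
configurations NOT covered are exactly the balanced ones.  Two kernel instances of «no balance»: **`noBalance_of_signWord`** (push word cut out by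
≤ 5 change points — pair the six equations with a sign-word function of #46 and take traces; the dual route to #46 §4) and **`noBalance_of_six`** (touches
among six designated abscissae — pair with the interpolating sum of #45 entry by entry, a sum of squares vanishes; the dual route to #45).
READING for (R): a balance needs the `|J|` tensors `γ(τ_j) ⊗ P(τ_j)` (`γ(τ) = (e^{δ_l τ})_l ∈ ℝ⁶`, `P(τ_j)` rank one) to be positively dependent;
since `≤ 6` point evaluations of the exponential Chebyshev system are independent and a kernel vector of `7 ≤ N ≤ 10` evaluations changes sign `≥ 6`
times, balanced profiles have `≥ 7` touches, and `≥ 9` if the null directions of the touches span `ℝ³` (paper count in the seat memo; not typed here).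
Nothing here bears on `DoorA26`, `DoorA34`, (W)/(M)/(R), `MatrixDescartes` (18050) or `VP ≠ VNP`; registers unchanged.

[folklore] Gordan 1873 (cited from the tree's Literature file); polar form of the 2 × 2 determinant; [this work] the packaging.
-/

-- `Summit.ValiantsHypothesis.ValiantsHypothesis.…` repeats a component by the D-0017 layout
-- (single-conjunct summit), which the `dupNamespace` linter flags; the name is mandated.
set_option linter.dupNamespace false


namespace Summit.ValiantsHypothesis.ValiantsHypothesis.Theorems.LacunarySymmetroidMatrixDescartes.WallBubbling

open Finset Filter Topology
open Bubbling (TwentyLocus)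

/-- **Gordan's alternative** in the shape used below: for finitely many vectors `V_j : κ → ℝ`, either some `q` has `Σ_i V_j(i) q(i) > 0` for every
`j`, or a convex combination of the `V_j` vanishes.  CITED, not re-proved: a repackaging of the tree's
`Literature.Analysis.Convex.GordanAlternativeLogSumExp.gordan_alternative` (Borwein–Zhu, Thm. 2.4.3) for the matrix `A m i = −V m i`.
[cite: BorweinZhu2005, §2.4.2 Theorem 2.4.3] -/
theorem gordan {ι κ : Type*} [Fintype ι] [Fintype κ] [DecidableEq κ] (V : ι → (κ → ℝ)) :
    (∃ q : κ → ℝ, ∀ j, 0 < ∑ i, V j i * q i) ∨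
    (∃ μ : ι → ℝ, (∀ j, 0 ≤ μ j) ∧ (∑ j, μ j = 1) ∧ ∀ i, ∑ j, μ j * V j i = 0) := by
  classical
  rcases isEmpty_or_nonempty ι with hι | hι
  · exact Or.inl ⟨0, fun j => (IsEmpty.false j).elim⟩
  let A : Matrix ι κ ℝ := Matrix.of fun m i => -V m i
  rcases (Literature.Analysis.Convex.GordanAlternativeLogSumExp.gordan_alternative A) with ⟨⟨w, hw, hwA⟩, -⟩ | ⟨⟨x, hx⟩, -⟩
  · right
    refine ⟨w, fun j => hw.1 j, hw.2, fun i => ?_⟩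
    have h := congrFun hwA i
    simp only [Matrix.vecMul, dotProduct, Matrix.of_apply, Pi.zero_apply, A] at h
    have : ∑ j, w j * V j i = -∑ j, w j * -V j i := by
      rw [← Finset.sum_neg_distrib]; refine Finset.sum_congr rfl fun j _ => by ring
    rw [this, h, neg_zero]
  · left
    refine ⟨x, fun j => ?_⟩
    have h := hx j
    simp only [Matrix.mulVec, dotProduct, Matrix.of_apply, A] at h
    have : ∑ i, V j i * x i = -∑ i, -V j i * x i := by
      rw [← Finset.sum_neg_distrib]; refine Finset.sum_congr rfl fun i _ => by ring
    rw [this]; linarith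

/-- The coordinate shift letters are symmetric. [folklore] -/
theorem isSymm_coordLetter (w : Fin 6 → Fin 3 → ℝ) (l : Fin 6) :
    (!![w l 0, w l 1; w l 1, w l 2] : Matrix (Fin 2) (Fin 2) ℝ).IsSymm := by
  apply Matrix.IsSymm.ext; intro i j
  fin_cases i <;> fin_cases j <;> rfl

/-- An exponential pencil of symmetric letters is symmetric at every time. [folklore] -/
theorem isSymm_expPencil (δ : Fin 6 → ℝ) (S : Fin 6 → Matrix (Fin 2) (Fin 2) ℝ) (hS : ∀ l, (S l).IsSymm) (t : ℝ) :
    (∑ l, Real.exp (δ l * t) • S l).IsSymm := by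
  apply Matrix.IsSymm.ext; intro i j
  simp only [Matrix.sum_apply, Matrix.smul_apply, smul_eq_mul]
  refine Finset.sum_congr rfl fun l _ => ?_
  rw [(hS l).apply i j]

/-- The first-order push of `det` along the coordinate shift pencil, as a linear form in the `18` coordinates. [folklore] -/
theorem polar_coordShift (δ : Fin 6 → ℝ) (P : Matrix (Fin 2) (Fin 2) ℝ) (w : Fin 6 → Fin 3 → ℝ) (t : ℝ) :
    (P + ∑ l, Real.exp (δ l * t) • (!![w l 0, w l 1; w l 1, w l 2] : Matrix (Fin 2) (Fin 2) ℝ)).det - P.det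
      - (∑ l, Real.exp (δ l * t) • (!![w l 0, w l 1; w l 1, w l 2] : Matrix (Fin 2) (Fin 2) ℝ)).det
      = ∑ l, Real.exp (δ l * t) * (P 1 1 * w l 0 - (P 0 1 + P 1 0) * w l 1 + P 0 0 * w l 2) := by
  simp only [Matrix.det_fin_two, Matrix.add_apply, Matrix.smul_apply, smul_eq_mul,
    Matrix.of_apply, Matrix.cons_val', Matrix.cons_val_zero, Matrix.cons_val_one, Matrix.empty_val',
    Matrix.cons_val_fin_one, Fin.sum_univ_succ, Fin.sum_univ_zero, add_zero]
  ring


/-- **THE FIRST-ORDER LIFT IN DUAL FORM (Gordan's alternative).**  Real exponents `δ`, symmetric letters, `21` increasing log-time abscissae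
`τ` with alternating virtual signs `κ`, and a set `J` of TOUCH abscissae: off `J`, `0 < κ_j det P(τ_j)`; on `J`, `det P(τ_j) = 0`.  NO-BALANCE
hypothesis: the only `μ ≥ 0` supported on `J` with `Σ_j μ_j κ_j e^{δ_l τ_j} P(τ_j) = 0` for EVERY exponent index `l` (six `2 × 2` matrix equations) is
`μ = 0`.  Then `δ ∈ TwentyLocus`.  Proof: Gordan's alternative for the `|J|` push functionals `Q ↦ κ_j·polar(P(τ_j), Q(τ_j))` on the `18`
coordinates of a symmetric shift pencil `Q = Σ_l e^{δ_l t} T_l`; a realising `Q` feeds the Q-lift `mem_twentyLocus_of_touches_alternations_pencilShift`,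
a vanishing convex combination is exactly a balance.  This is the complete first-order statement: a touch profile is first-order liftable iff it is
not balanced. [this work] -/
theorem mem_twentyLocus_of_touches_noBalance (δ : Fin 6 → ℝ) (S : Fin 6 → Matrix (Fin 2) (Fin 2) ℝ)
    (hS : ∀ l, (S l).IsSymm) (τ : Fin 21 → ℝ) (hτ : StrictMono τ) (κ : Fin 21 → ℝ) (J : Finset (Fin 21))
    (hoff : ∀ j ∉ J, 0 < κ j * (∑ l, Real.exp (δ l * τ j) • S l).det)
    (hon : ∀ j ∈ J, (∑ l, Real.exp (δ l * τ j) • S l).det = 0)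
    (hbal : ∀ μ : Fin 21 → ℝ, (∀ j, 0 ≤ μ j) → (∀ j ∉ J, μ j = 0) →
      (∀ l, ∑ j, (μ j * κ j * Real.exp (δ l * τ j)) • (∑ l', Real.exp (δ l' * τ j) • S l') = 0) → ∀ j, μ j = 0)
    (halt : ∀ j : Fin 20, κ j.castSucc * κ j.succ < 0) :
    δ ∈ TwentyLocus := by
  classical
  -- the touch functionals in the 18 shift coordinates `(l, i)`, `i = 0, 1, 2` ↔ entries `T_l 00, T_l 01 = T_l 10, T_l 11`
  let P : Fin 21 → Matrix (Fin 2) (Fin 2) ℝ := fun j => ∑ l, Real.exp (δ l * τ j) • S l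
  let c3 : Fin 21 → Fin 3 → ℝ := fun j => ![(P j) 1 1, -((P j) 0 1 + (P j) 1 0), (P j) 0 0]
  let V : J → (Fin 6 × Fin 3 → ℝ) := fun j li => κ j * Real.exp (δ li.1 * τ j) * c3 j li.2
  have hPsymm : ∀ j, (P j) 0 1 = (P j) 1 0 := fun j => ((isSymm_expPencil δ S hS (τ j)).apply 0 1).symm
  rcases gordan V with ⟨q, hq⟩ | ⟨μ, hμ0, hμ1, hμV⟩
  · -- a shift pencil realising every push sign ⇒ Q-lift
    let w : Fin 6 → Fin 3 → ℝ := fun l i => q (l, i)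
    let T : Fin 6 → Matrix (Fin 2) (Fin 2) ℝ := fun l => !![w l 0, w l 1; w l 1, w l 2]
    refine mem_twentyLocus_of_touches_alternations_pencilShift δ S T hS (fun l => isSymm_coordLetter w l) τ hτ κ ?_ halt
    intro j
    by_cases hj : j ∈ J
    · refine Or.inr (Or.inl ⟨hon j hj, ?_⟩)
      have hpol := polar_coordShift δ (P j) w (τ j)
      have hsum : κ j * (∑ l, Real.exp (δ l * τ j) * ((P j) 1 1 * w l 0 - ((P j) 0 1 + (P j) 1 0) * w l 1 + (P j) 0 0 * w l 2))
          = ∑ li : Fin 6 × Fin 3, V ⟨j, hj⟩ li * q li := by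
        rw [Fintype.sum_prod_type, Finset.mul_sum]
        refine Finset.sum_congr rfl fun l _ => ?_
        simp only [Fin.sum_univ_three, V, c3, w, Matrix.cons_val_zero, Matrix.cons_val_one, Matrix.cons_val_two,
          Matrix.head_cons, Matrix.tail_cons]
        ring
      have hpos := hq ⟨j, hj⟩
      rw [← hsum, ← hpol] at hpos
      exact hpos
    · exact Or.inl (hoff j hj)
  · -- a vanishing convex combination = a balance: contradiction
    exfalso
    let μ' : Fin 21 → ℝ := fun j => if hj : j ∈ J then μ ⟨j, hj⟩ else 0
    have hμ'J : ∀ j : J, μ' j = μ j := fun j => by simp only [μ', dif_pos j.2]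
    have hrestrict : ∀ g : Fin 21 → ℝ, (∑ j, μ' j * g j) = ∑ j : J, μ j * g j := by
      intro g
      have h1 : (∑ j, μ' j * g j) = ∑ j ∈ J, μ' j * g j := by
        rw [← Finset.sum_subset (Finset.subset_univ J)]
        intro j _ hj
        simp only [μ', dif_neg hj, zero_mul]
      rw [h1, ← Finset.sum_coe_sort J (fun j => μ' j * g j)]
      refine Finset.sum_congr rfl fun j _ => ?_
      rw [hμ'J j]
    have hz := hbal μ' (fun j => by
        simp only [μ']; split_ifs with h
        · exact hμ0 _
        · exact le_rfl) (fun j hj => by simp only [μ', dif_neg hj]) ?_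
    · have h1 : (∑ j : J, μ j) = 0 := by
        rw [Finset.sum_congr rfl (fun (j : J) _ => (hμ'J j).symm)]
        simp [hz]
      linarith
    · intro l
      have e0 := hμV (l, 0)
      have e1 := hμV (l, 1)
      have e2 := hμV (l, 2)
      simp only [V, c3, Matrix.cons_val_zero, Matrix.cons_val_one, Matrix.cons_val_two, Matrix.head_cons,
        Matrix.tail_cons] at e0 e1 e2
      -- the off-diagonal equation, using the symmetry of `P j`
      have e1' : (∑ j : J, μ j * (κ j * Real.exp (δ l * τ j) * (P j) 0 1)) = 0 := by
        have : (∑ j : J, μ j * (κ j * Real.exp (δ l * τ j) * -((P j) 0 1 + (P j) 1 0)))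
            = -2 * ∑ j : J, μ j * (κ j * Real.exp (δ l * τ j) * (P j) 0 1) := by
          rw [Finset.mul_sum]
          refine Finset.sum_congr rfl fun j _ => ?_
          rw [← hPsymm j]; ring
        rw [this] at e1
        linarith
      have hentry : ∀ a b : Fin 2, (∑ j : J, μ j * (κ j * Real.exp (δ l * τ j) * (P j) a b)) = 0 := by
        intro a b
        fin_cases a <;> fin_cases b
        · exact e2
        · exact e1'
        · -- entry (1,0) = (0,1)
          have : (∑ j : J, μ j * (κ j * Real.exp (δ l * τ j) * (P j) 1 0))
              = ∑ j : J, μ j * (κ j * Real.exp (δ l * τ j) * (P j) 0 1) :=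
            Finset.sum_congr rfl fun j _ => by rw [hPsymm j]
          exact this.trans e1'
        · exact e0
      ext a b
      rw [Matrix.sum_apply, Matrix.zero_apply]
      have hterm : ∀ j : Fin 21, ((μ' j * κ j * Real.exp (δ l * τ j)) • P j) a b
          = μ' j * (κ j * Real.exp (δ l * τ j) * (P j) a b) := by
        intro j; rw [Matrix.smul_apply, smul_eq_mul]; ring
      calc (∑ j, ((μ' j * κ j * Real.exp (δ l * τ j)) • (∑ l', Real.exp (δ l' * τ j) • S l')) a b)
          = ∑ j, μ' j * (κ j * Real.exp (δ l * τ j) * (P j) a b) := Finset.sum_congr rfl fun j _ => hterm j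
        _ = ∑ j : J, μ j * (κ j * Real.exp (δ l * τ j) * (P j) a b) := hrestrict _
        _ = 0 := hentry a b


/-- **No balance along a realisable sign word** (the dual route to `mem_twentyLocus_of_touches_alternations_signWord`).  If the required push
signs along the touches are cut out by `q ≤ 5` change points `u` — `0 < ε κ_j (∏_i (u_i − τ_j)) tr P(τ_j)` on `J` — then no balance exists: pair the
six matrix equations with the coefficients of a sign-word function `φ` (`exists_expSum_signWord`) and take the trace. [this work] -/
theorem noBalance_of_signWord (δ : Fin 6 → ℝ) (hd : StrictMono δ) (S : Fin 6 → Matrix (Fin 2) (Fin 2) ℝ)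
    (τ : Fin 21 → ℝ) (κ : Fin 21 → ℝ) (J : Finset (Fin 21)) {q : ℕ} (hq : q < 6) (u : Fin q → ℝ)
    (hu : StrictMono u) (ε : ℝ)
    (hon : ∀ j ∈ J, (∀ i, τ j ≠ u i) ∧ 0 < ε * κ j * (∏ i, (u i - τ j)) * (∑ l, Real.exp (δ l * τ j) • S l).trace)
    (μ : Fin 21 → ℝ) (hμ0 : ∀ j, 0 ≤ μ j) (hμJ : ∀ j ∉ J, μ j = 0)
    (hμ : ∀ l, ∑ j, (μ j * κ j * Real.exp (δ l * τ j)) • (∑ l', Real.exp (δ l' * τ j) • S l') = 0) :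
    ∀ j, μ j = 0 := by
  classical
  obtain ⟨c, hc⟩ := exists_expSum_signWord δ hd hq u hu
  -- pair the matrix equations with `ε c_l` and take the trace
  set P : Fin 21 → Matrix (Fin 2) (Fin 2) ℝ := fun j => ∑ l', Real.exp (δ l' * τ j) • S l' with hP
  have htr : ∑ j, μ j * (ε * κ j * (∑ l, c l * Real.exp (δ l * τ j)) * (P j).trace) = 0 := by
    have h1 : ∀ l, (ε * c l) * (∑ j, (μ j * κ j * Real.exp (δ l * τ j)) • P j).trace = 0 := by
      intro l; rw [hμ l, Matrix.trace_zero, mul_zero]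
    have key : ∀ j, μ j * (ε * κ j * (∑ l, c l * Real.exp (δ l * τ j)) * (P j).trace)
        = ∑ l, (ε * c l) * (μ j * κ j * Real.exp (δ l * τ j) * (P j).trace) := by
      intro j
      simp only [Finset.mul_sum, Finset.sum_mul]
      refine Finset.sum_congr rfl fun l _ => ?_
      ring
    calc ∑ j, μ j * (ε * κ j * (∑ l, c l * Real.exp (δ l * τ j)) * (P j).trace)
        = ∑ j, ∑ l, (ε * c l) * (μ j * κ j * Real.exp (δ l * τ j) * (P j).trace) := Finset.sum_congr rfl fun j _ => key j
      _ = ∑ l, ∑ j, (ε * c l) * (μ j * κ j * Real.exp (δ l * τ j) * (P j).trace) := Finset.sum_comm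
      _ = ∑ l, (ε * c l) * (∑ j, (μ j * κ j * Real.exp (δ l * τ j)) • P j).trace := by
          refine Finset.sum_congr rfl fun l _ => ?_
          rw [Matrix.trace_sum, Finset.mul_sum]
          refine Finset.sum_congr rfl fun j _ => ?_
          rw [Matrix.trace_smul, smul_eq_mul]
      _ = 0 := Finset.sum_eq_zero fun l _ => h1 l
  -- every term is `μ_j × (positive)` on `J` and `0` off `J`
  have hterm : ∀ j, 0 ≤ μ j * (ε * κ j * (∑ l, c l * Real.exp (δ l * τ j)) * (P j).trace) := by
    intro j
    by_cases hj : j ∈ J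
    · obtain ⟨hne, hk⟩ := hon j hj
      have hφ := hc (τ j) hne
      have hP2 : 0 < (∏ i, (u i - τ j)) ^ 2 := by
        have : (∏ i, (u i - τ j)) ≠ 0 := Finset.prod_ne_zero_iff.2 fun i _ => sub_ne_zero.2 (hne i).symm
        positivity
      have hprod := mul_pos hk hφ
      have hre : ε * κ j * (∏ i, (u i - τ j)) * (∑ l, Real.exp (δ l * τ j) • S l).trace
            * ((∏ i, (u i - τ j)) * ∑ l, c l * Real.exp (δ l * τ j))
          = (ε * κ j * (∑ l, c l * Real.exp (δ l * τ j)) * (∑ l, Real.exp (δ l * τ j) • S l).trace)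
            * (∏ i, (u i - τ j)) ^ 2 := by ring
      rw [hre] at hprod
      exact mul_nonneg (hμ0 j) ((mul_pos_iff_of_pos_right hP2).1 hprod).le
    · rw [hμJ j hj, zero_mul]
  have hzero := (Finset.sum_eq_zero_iff_of_nonneg (fun j _ => hterm j)).1 htr
  intro j
  by_cases hj : j ∈ J
  · obtain ⟨hne, hk⟩ := hon j hj
    have hφ := hc (τ j) hne
    have hP2 : 0 < (∏ i, (u i - τ j)) ^ 2 := by
      have : (∏ i, (u i - τ j)) ≠ 0 := Finset.prod_ne_zero_iff.2 fun i _ => sub_ne_zero.2 (hne i).symm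
      positivity
    have hprod := mul_pos hk hφ
    have hre : ε * κ j * (∏ i, (u i - τ j)) * (∑ l, Real.exp (δ l * τ j) • S l).trace
          * ((∏ i, (u i - τ j)) * ∑ l, c l * Real.exp (δ l * τ j))
        = (ε * κ j * (∑ l, c l * Real.exp (δ l * τ j)) * (∑ l, Real.exp (δ l * τ j) • S l).trace)
          * (∏ i, (u i - τ j)) ^ 2 := by ring
    rw [hre] at hprod
    have hpos : 0 < ε * κ j * (∑ l, c l * Real.exp (δ l * τ j)) * (∑ l, Real.exp (δ l * τ j) • S l).trace :=
      (mul_pos_iff_of_pos_right hP2).1 hprod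
    have h0 := hzero j (Finset.mem_univ j)
    rcases mul_eq_zero.1 h0 with h | h
    · exact h
    · exact absurd h hpos.ne'
  · exact hμJ j hj



/-- **No balance for at most six touches** (the dual route to #45 `mem_twentyLocus_of_touches_alternations_six`).  If the touch abscissae are among six
designated ones `e : Fin 6 ↪ Fin 21` (exponents and abscissae strictly increasing) and at every touch `κ_j ≠ 0 ≠ tr P(τ_j)`, then no balance exists:
pair the six matrix equations with the coefficients of the exponential sum interpolating `μ_j κ_j P(τ_j)_{ab}` at the designated nodes
(`exists_expSum_interpolate`) — a sum of squares vanishes. [this work] -/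
theorem noBalance_of_six (δ : Fin 6 → ℝ) (hd : StrictMono δ) (S : Fin 6 → Matrix (Fin 2) (Fin 2) ℝ)
    (τ : Fin 21 → ℝ) (hτ : StrictMono τ) (κ : Fin 21 → ℝ) (J : Finset (Fin 21)) (e : Fin 6 → Fin 21) (he : Function.Injective e)
    (hJ : ∀ j ∈ J, j ∈ Set.range e)
    (hon : ∀ j ∈ J, κ j ≠ 0 ∧ (∑ l, Real.exp (δ l * τ j) • S l).trace ≠ 0)
    (μ : Fin 21 → ℝ) (hμJ : ∀ j ∉ J, μ j = 0)
    (hμ : ∀ l, ∑ j, (μ j * κ j * Real.exp (δ l * τ j)) • (∑ l', Real.exp (δ l' * τ j) • S l') = 0) :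
    ∀ j, μ j = 0 := by
  classical
  set P : Fin 21 → Matrix (Fin 2) (Fin 2) ℝ := fun j => ∑ l', Real.exp (δ l' * τ j) • S l' with hP
  -- off the designated nodes `μ` vanishes
  have hμe : ∀ j, j ∉ Set.range e → μ j = 0 := fun j hj => hμJ j (fun hjJ => hj (hJ j hjJ))
  -- every entry of `μ_j κ_j P_j` vanishes at the designated nodes
  have hent : ∀ a b : Fin 2, ∀ i : Fin 6, μ (e i) * κ (e i) * (P (e i)) a b = 0 := by
    intro a b
    obtain ⟨c, hc⟩ := exists_expSum_interpolate δ hd.injective (fun i => τ (e i)) (hτ.injective.comp he)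
      (fun i => μ (e i) * κ (e i) * (P (e i)) a b)
    -- pair the matrix equations (entry `a b`) with `c`
    have h0 : ∑ j, μ j * κ j * (P j) a b * (∑ l, c l * Real.exp (δ l * τ j)) = 0 := by
      have h1 : ∀ l, c l * (∑ j, (μ j * κ j * Real.exp (δ l * τ j)) • P j) a b = 0 := by
        intro l; rw [hμ l, Matrix.zero_apply, mul_zero]
      calc ∑ j, μ j * κ j * (P j) a b * (∑ l, c l * Real.exp (δ l * τ j))
          = ∑ j, ∑ l, c l * (μ j * κ j * Real.exp (δ l * τ j) * (P j) a b) := by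
            refine Finset.sum_congr rfl fun j _ => ?_
            rw [Finset.mul_sum]
            refine Finset.sum_congr rfl fun l _ => ?_
            ring
        _ = ∑ l, ∑ j, c l * (μ j * κ j * Real.exp (δ l * τ j) * (P j) a b) := Finset.sum_comm
        _ = ∑ l, c l * (∑ j, (μ j * κ j * Real.exp (δ l * τ j)) • P j) a b := by
            refine Finset.sum_congr rfl fun l _ => ?_
            rw [Matrix.sum_apply, Finset.mul_sum]
            refine Finset.sum_congr rfl fun j _ => ?_
            rw [Matrix.smul_apply, smul_eq_mul]
        _ = 0 := Finset.sum_eq_zero fun l _ => h1 l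
    -- restrict to the designated nodes: a sum of squares
    have hmap : ∑ j, μ j * κ j * (P j) a b * (∑ l, c l * Real.exp (δ l * τ j))
        = ∑ i, (μ (e i) * κ (e i) * (P (e i)) a b) ^ 2 := by
      rw [← Finset.sum_subset (Finset.subset_univ (Finset.univ.map ⟨e, he⟩))]
      · rw [Finset.sum_map]
        refine Finset.sum_congr rfl fun i _ => ?_
        simp only [Function.Embedding.coeFn_mk]
        rw [hc i]; ring
      · intro j _ hj
        have : j ∉ Set.range e := by
          rintro ⟨i, rfl⟩; exact hj (Finset.mem_map.2 ⟨i, Finset.mem_univ i, rfl⟩)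
        rw [hμe j this]; ring
    rw [hmap] at h0
    have hz := (Finset.sum_eq_zero_iff_of_nonneg (fun i _ => sq_nonneg (μ (e i) * κ (e i) * (P (e i)) a b))).1 h0
    intro i
    exact pow_eq_zero_iff (n := 2) (by norm_num) |>.1 (hz i (Finset.mem_univ i))
  intro j
  by_cases hj : j ∈ J
  · obtain ⟨i, rfl⟩ := hJ j hj
    obtain ⟨hk, htr⟩ := hon _ hj
    have h00 := hent 0 0 i
    have h11 := hent 1 1 i
    have hsum : μ (e i) * κ (e i) * (P (e i)).trace = 0 := by
      rw [Matrix.trace_fin_two]; linear_combination h00 + h11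
    rcases mul_eq_zero.1 hsum with h | h
    · rcases mul_eq_zero.1 h with h' | h'
      · exact h'
      · exact absurd h' hk
    · exact absurd h htr
  · exact hμJ j hj


end Summit.ValiantsHypothesis.ValiantsHypothesis.Theorems.LacunarySymmetroidMatrixDescartes.WallBubbling
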